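import Mathlib
import Summits.CriticalPhenomena.CardyFormulaZ2.Theorems.CardyMagicRigidityNestingRigidityTransferReduction
import HarnessLib

/-!
# Stub S6 · `Transfer`: ancestor and strict-ancestor counts from one- and two-disc surround counts

Crux `Summit.CriticalPhenomena.CardyFormulaZ2.Theses.CardyMagicRigidity.NestingRigidity`
(stmt-CriticalPhenomena-4835), line `ring-cloud-tomography` (r3), registered stub
`stub_transfer : Transfer` (`NestingStatisticsAgree → LoopLimitZ2EqT`); continuation of
`…TransferReduction` (p112841: glue `transfer_of_precompactness`, interiors of regular loops,
`patternCount_eq_of_interiorEquiv`).  Step (ii) of the route of `stub_transfer` (and of the sibling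
`stub_treeRigidity`) must RECONSTRUCT a regular limit configuration from its nesting-tree statistics.
This file proves, sorry-free and at the configuration level, the deterministic formulas behind that
reconstruction: for a `Regular` configuration `c`, an open set `G ⊇ B̄(z₀, r₀)` (`r₀ > 0`) and a
window `B(0, R)`,

* §1 `patternCount_fin_one_univ`, `patternCount_fin_two_univ` — the one- and two-disc pattern counts
  at `S = univ` are the numbers of loops of the window surrounding the disc(s) (the avoidance clause is
  vacuous);
* §2 `exists_rat_closedBall_near` (rational closed discs of any smallness about any point),
  `interiors_nested_of_wind_ne_zero` (loops of a regular configuration surrounding a common point are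
  NESTED: `Regular.laminar`), `finite_loops_surrounding_closedBall` (finitely many loops of a window
  surround a disc of positive radius: `Regular.locallyFinite` + the sibling seat's
  `le_diam_range_of_closedBall_subset`);
* §3 `exists_rat_closedBall_cutting`, `ncard_loops_surrounding_eq_sInf` — the ANCESTOR COUNT
  `#{u : trace u ⊆ B(0,R), G ⊆ int u}` is the least element of
  `{N(B̄(z₀,r₀); R)} ∪ {N(B̄(z₀,r₀), B̄(q,s); R) : B̄(q,s) ⊆ G rational, r₀ + s < ‖z₀ − q‖}` (one- and
  two-disc surround counts with the separation of `NestingStatisticsAgree`): the loops surrounding the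
  base disc form a finite chain, and a small rational disc about a point of `G` missed by the largest
  non-ancestor cuts the chain exactly at the ancestors;
* §4 `ncard_loops_ssurrounding_eq_sSup` — the STRICT-ANCESTOR COUNT `#{u : G ⊂ int u}` is the supremum
  of the ancestor counts of the open sets `G ∪ B(q, s)`, `B(q, s) ⊄ G` rational (a rational disc inside
  the smallest strict ancestor about a point outside `G`); `ncard_loops_surrounding_eq_add` —
  ancestors = loops with interior exactly `G` + strict ancestors.

Hence the multiplicity of every open set as a winding interior of a loop of the window is an explicit
function of the one- and two-disc surround counts at rational data; the consequences (equal counts ⇒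
equal interior multisets ⇒ interior-preserving bijection ⇒ ALL pattern counts equal) are drawn in
`…TransferRigidity`.
-/

noncomputable section

open MeasureTheory Set Filter Metric
open scoped Real Topology BigOperators

namespace Summit.CriticalPhenomena.CardyFormulaZ2.Cruxes.NestingRigidity.RingCloudTomography

open Literature.Probability.RandomPlanarGeometry Literature.Probability.Percolation
  Literature.Probability.LatticeModels
open Summit.CriticalPhenomena.CardyFormulaZ2.Theses.CardyMagicRigidity
open Summit.CriticalPhenomena.CardyFormulaZ2.Cruxes.NestingRigidity.PositiveConeWeightDoubling

/-! ## §1 One- and two-disc surround counts as cardinalities -/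

/-- For one disc and `S = univ` the avoidance clause of `patternCount` is vacuous: the count is the
number of loops of the window surrounding the disc. -/
theorem patternCount_fin_one_univ (c : LoopConfig ℂ) (z₀ : ℂ) (r₀ R : ℝ) :
    patternCount c ![z₀] ![r₀] R Finset.univ =
      {u ∈ c.loops | u.range ⊆ ball (0 : ℂ) R ∧ closedBall z₀ r₀ ⊆ {w | u.wind w ≠ 0}}.ncard := by
  unfold patternCount
  congr 1
  ext u
  simp [Fin.forall_fin_one]

/-- For two discs and `S = univ`: the count is the number of loops of the window surrounding both
discs. -/
theorem patternCount_fin_two_univ (c : LoopConfig ℂ) (z₀ z₁ : ℂ) (r₀ r₁ R : ℝ) :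
    patternCount c ![z₀, z₁] ![r₀, r₁] R Finset.univ =
      {u ∈ c.loops | u.range ⊆ ball (0 : ℂ) R ∧ closedBall z₀ r₀ ⊆ {w | u.wind w ≠ 0} ∧
        closedBall z₁ r₁ ⊆ {w | u.wind w ≠ 0}}.ncard := by
  unfold patternCount
  congr 1
  ext u
  simp [Fin.forall_fin_two]

/-! ## §2 Rational discs near a point; the chain of loops surrounding a point -/

/-- A point of the plane lies in rational closed discs of arbitrarily small size around it: for
`ε > 0` there is a closed disc with rational centre `q` and rational radius `s > 0` with
`dist z q < s` and `s + dist z q < ε` (so `z ∈ B(q, s)` and `B̄(q, s) ⊆ B(z, ε)`). -/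
theorem exists_rat_closedBall_near (z : ℂ) {ε : ℝ} (hε : 0 < ε) :
    ∃ (q : ℚ × ℚ) (s : ℚ), 0 < s ∧ dist z (⟨q.1, q.2⟩ : ℂ) < s ∧
      (s : ℝ) + dist z (⟨q.1, q.2⟩ : ℂ) < ε := by
  obtain ⟨q₁, hq₁, hq₁'⟩ := exists_rat_btwn (show z.re - ε / 8 < z.re + ε / 8 by linarith)
  obtain ⟨q₂, hq₂, hq₂'⟩ := exists_rat_btwn (show z.im - ε / 8 < z.im + ε / 8 by linarith)
  set w : ℂ := ⟨q₁, q₂⟩ with hw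
  have hd : dist z w < ε / 4 := by
    rw [dist_eq_norm]
    refine (Complex.norm_le_abs_re_add_abs_im _).trans_lt ?_
    have h1 : |(z - w).re| < ε / 8 := by
      rw [Complex.sub_re, abs_lt]; simp only [hw]; constructor <;> linarith
    have h2 : |(z - w).im| < ε / 8 := by
      rw [Complex.sub_im, abs_lt]; simp only [hw]; constructor <;> linarith
    linarith
  obtain ⟨s, hs, hs'⟩ := exists_rat_btwn (show dist z w < ε / 2 by linarith)
  exact ⟨(q₁, q₂), s, by exact_mod_cast dist_nonneg.trans_lt hs, hs, by linarith⟩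

/-- The closed disc of `exists_rat_closedBall_near` lies in the `ε`-ball about the point. -/
theorem closedBall_subset_ball_of_add_dist_lt {z q : ℂ} {s ε : ℝ} (h : s + dist z q < ε) :
    closedBall q s ⊆ ball z ε := by
  intro y hy
  rw [mem_closedBall] at hy
  rw [mem_ball]
  calc dist y z ≤ dist y q + dist q z := dist_triangle y q z
    _ < ε := by rw [dist_comm q z]; linarith

/-- **Loops of a regular configuration surrounding a common point are nested** (laminarity: their
interiors are not disjoint). -/
theorem interiors_nested_of_wind_ne_zero {c : LoopConfig ℂ} (hc : Regular c) {u v : UnbasedLoop ℂ}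
    (hu : u ∈ c.loops) (hv : v ∈ c.loops) {z : ℂ} (hzu : u.wind z ≠ 0) (hzv : v.wind z ≠ 0) :
    {w | u.wind w ≠ 0} ⊆ {w | v.wind w ≠ 0} ∨ {w | v.wind w ≠ 0} ⊆ {w | u.wind w ≠ 0} := by
  rcases hc.laminar u hu v hv with h | h | h
  · exact Or.inl h
  · exact Or.inr h
  · exact (Set.disjoint_left.1 h hzu hzv).elim

/-- In a locally finite configuration, the loops of a window surrounding a closed disc of positive
radius form a finite set (they have diameter `≥` the radius, `le_diam_range_of_closedBall_subset`). -/
theorem finite_loops_surrounding_closedBall {c : LoopConfig ℂ} (hc : c.IsLocallyFinite) (z₀ : ℂ)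
    {r₀ : ℝ} (hr₀ : 0 < r₀) (R : ℝ) :
    {u ∈ c.loops | u.range ⊆ ball (0 : ℂ) R ∧ closedBall z₀ r₀ ⊆ {w | u.wind w ≠ 0}}.Finite := by
  refine ((hc 0 R r₀ hr₀).union (hc 1 R r₀ hr₀)).subset fun u hu ↦ ?_
  obtain ⟨hul, hur, hsur⟩ := hu
  have hd : r₀ ≤ diam u.range := le_diam_range_of_closedBall_subset hsur
  rcases LoopConfig.mem_loops_iff.1 hul with h | h
  · exact Or.inl ⟨h, hur, hd⟩
  · exact Or.inr ⟨h, hur, hd⟩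

/-! ## §3 Ancestor counts of an open set are attained infima of two-disc surround counts -/

/-- **The cutting disc.**  Let `c` be regular, `G` open, `B̄(z₀, r₀) ⊆ G` a closed disc of positive
radius, `R` a window.  Among the (finitely many, nested) loops of the window surrounding `B̄(z₀, r₀)`,
those surrounding the whole of `G` are either all of them, or exactly those surrounding in addition
one suitable RATIONAL closed disc `B̄(q, s) ⊆ G` separated from the base disc
(`r₀ + s < ‖z₀ − q‖`): take the loop with the largest interior among those NOT surrounding `G`, a
point of `G` it does not surround, and a small rational disc about that point. -/
theorem exists_rat_closedBall_cutting {c : LoopConfig ℂ} (hc : Regular c) {G : Set ℂ} (hG : IsOpen G)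
    {z₀ : ℂ} {r₀ : ℝ} (hr₀ : 0 < r₀) (hD : closedBall z₀ r₀ ⊆ G) (R : ℝ) :
    {u ∈ c.loops | u.range ⊆ ball (0 : ℂ) R ∧ G ⊆ {w | u.wind w ≠ 0}} =
        {u ∈ c.loops | u.range ⊆ ball (0 : ℂ) R ∧ closedBall z₀ r₀ ⊆ {w | u.wind w ≠ 0}} ∨
      ∃ (q : ℚ × ℚ) (s : ℚ), 0 < s ∧ closedBall (⟨q.1, q.2⟩ : ℂ) s ⊆ G ∧
        r₀ + s < ‖z₀ - ⟨q.1, q.2⟩‖ ∧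
        {u ∈ c.loops | u.range ⊆ ball (0 : ℂ) R ∧ G ⊆ {w | u.wind w ≠ 0}} =
          {u ∈ c.loops | u.range ⊆ ball (0 : ℂ) R ∧ closedBall z₀ r₀ ⊆ {w | u.wind w ≠ 0} ∧
            closedBall (⟨q.1, q.2⟩ : ℂ) s ⊆ {w | u.wind w ≠ 0}} := by
  classical
  set T : Set (UnbasedLoop ℂ) :=
    {u ∈ c.loops | u.range ⊆ ball (0 : ℂ) R ∧ G ⊆ {w | u.wind w ≠ 0}} with hT
  set Ch : Set (UnbasedLoop ℂ) :=
    {u ∈ c.loops | u.range ⊆ ball (0 : ℂ) R ∧ closedBall z₀ r₀ ⊆ {w | u.wind w ≠ 0}} with hCh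
  have hTCh : T ⊆ Ch := fun u hu ↦ ⟨hu.1, hu.2.1, hD.trans hu.2.2⟩
  by_cases hTeq : T = Ch
  · exact Or.inl hTeq
  right
  -- a loop of `Ch \ T` with the largest interior
  have hfin : (Ch \ T).Finite := (finite_loops_surrounding_closedBall hc.locallyFinite z₀ hr₀ R).sdiff
  have hne : (Ch \ T).Nonempty := Set.sdiff_nonempty.2 fun h ↦ hTeq (hTCh.antisymm h)
  obtain ⟨us, ⟨husCh, husT⟩, hmax⟩ :=
    hfin.exists_maximalFor (fun u : UnbasedLoop ℂ ↦ {w | u.wind w ≠ 0}) _ hne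
  have hz₀ : z₀ ∈ closedBall z₀ r₀ := mem_closedBall_self hr₀.le
  have hbelow : ∀ u ∈ Ch \ T, {w | u.wind w ≠ 0} ⊆ {w | us.wind w ≠ 0} := by
    intro u hu
    rcases interiors_nested_of_wind_ne_zero hc hu.1.1 husCh.1 (hu.1.2.2 hz₀) (husCh.2.2 hz₀) with
      h | h
    · exact h
    · exact hmax hu h
  -- a point of `G` not surrounded by `us`
  have hnot : ¬ G ⊆ {w | us.wind w ≠ 0} := fun h ↦ husT ⟨husCh.1, husCh.2.1, h⟩
  obtain ⟨zs, hzsG, hzs⟩ := Set.not_subset.1 hnot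
  have hzsD : r₀ < dist zs z₀ := by
    by_contra h
    exact hzs (husCh.2.2 (mem_closedBall.2 (not_lt.1 h)))
  -- a small rational disc about it, inside `G` and separated from the base disc
  obtain ⟨ε, hε, hball⟩ := Metric.isOpen_iff.1 hG zs hzsG
  obtain ⟨q, s, hs, hdist, hsum⟩ := exists_rat_closedBall_near zs (lt_min hε (sub_pos.2 hzsD))
  have hsubG : closedBall (⟨q.1, q.2⟩ : ℂ) s ⊆ G :=
    (closedBall_subset_ball_of_add_dist_lt (hsum.trans_le (min_le_left _ _))).trans hball
  have hsep : r₀ + s < ‖z₀ - ⟨q.1, q.2⟩‖ := by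
    have h1 : (s : ℝ) + dist zs ⟨q.1, q.2⟩ < dist zs z₀ - r₀ := hsum.trans_le (min_le_right _ _)
    have h2 : dist zs z₀ ≤ dist zs ⟨q.1, q.2⟩ + dist (⟨q.1, q.2⟩ : ℂ) z₀ := dist_triangle _ _ _
    rw [← dist_eq_norm, dist_comm]
    linarith
  have hzsq : zs ∈ closedBall (⟨q.1, q.2⟩ : ℂ) s := mem_closedBall.2 hdist.le
  refine ⟨q, s, hs, hsubG, hsep, Set.ext fun u ↦ ⟨fun hu ↦ ?_, fun hu ↦ ?_⟩⟩
  · exact ⟨hu.1, hu.2.1, hD.trans hu.2.2, hsubG.trans hu.2.2⟩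
  · by_contra huT
    have huCh : u ∈ Ch := ⟨hu.1, hu.2.1, hu.2.2.1⟩
    exact hzs (hbelow u ⟨huCh, huT⟩ (hu.2.2.2 hzsq))

/-- **Ancestor counts are attained infima of surround counts.**  For `c` regular, `G` open containing
the closed disc `B̄(z₀, r₀)` of positive radius, and a window `R`, the number of loops of the window
whose interior contains `G` is the least element of
`{N(B̄(z₀,r₀); R)} ∪ {N(B̄(z₀,r₀), B̄(q,s); R) : B̄(q,s) ⊆ G rational, r₀ + s < ‖z₀ − q‖}` — one- and
two-disc `patternCount`s at `S = univ` with the separation of `NestingStatisticsAgree`. -/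
theorem ncard_loops_surrounding_eq_sInf : ∀ {c : LoopConfig ℂ}, Regular c → ∀ {G : Set ℂ},
    IsOpen G → ∀ {z₀ : ℂ} {r₀ : ℝ}, 0 < r₀ → Metric.closedBall z₀ r₀ ⊆ G → ∀ (R : ℝ),
    {u ∈ c.loops | u.range ⊆ Metric.ball (0 : ℂ) R ∧ G ⊆ {w | u.wind w ≠ 0}}.ncard =
      sInf (insert (patternCount c ![z₀] ![r₀] R Finset.univ)
        {m | ∃ (q : ℚ × ℚ) (s : ℚ), 0 < s ∧ Metric.closedBall (⟨q.1, q.2⟩ : ℂ) s ⊆ G ∧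
          r₀ + s < ‖z₀ - ⟨q.1, q.2⟩‖ ∧
          m = patternCount c ![z₀, ⟨q.1, q.2⟩] ![r₀, (s : ℝ)] R Finset.univ}) := by
  intro c hc G hG z₀ r₀ hr₀ hD R
  have hChfin := finite_loops_surrounding_closedBall hc.locallyFinite z₀ hr₀ R
  symm
  refine IsLeast.csInf_eq ⟨?_, ?_⟩
  · -- the ancestor count is a member
    rcases exists_rat_closedBall_cutting hc hG hr₀ hD R with h | ⟨q, s, hs, hsub, hsep, h⟩
    · left
      rw [h, patternCount_fin_one_univ]
    · right
      exact ⟨q, s, hs, hsub, hsep, by rw [h, patternCount_fin_two_univ]⟩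
  · -- and a lower bound
    rintro m (rfl | ⟨q, s, hs, hsub, hsep, rfl⟩)
    · rw [patternCount_fin_one_univ]
      exact Set.ncard_le_ncard (fun u hu ↦ ⟨hu.1, hu.2.1, hD.trans hu.2.2⟩) hChfin
    · rw [patternCount_fin_two_univ]
      exact Set.ncard_le_ncard (fun u hu ↦ ⟨hu.1, hu.2.1, hD.trans hu.2.2, hsub.trans hu.2.2⟩)
        (hChfin.subset fun u hu ↦ ⟨hu.1, hu.2.1, hu.2.2.1⟩)

/-! ## §4 Strict ancestors and multiplicities -/

/-- **Strict-ancestor counts are suprema of ancestor counts of enlarged sets.**  For `c` regular,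
`G` open containing a closed disc of positive radius, and a window `R`, the number of loops of the
window whose interior STRICTLY contains `G` is the supremum (attained, or `0`) of the ancestor counts
of the open sets `G ∪ B(q, s)` over the rational open discs `B(q, s) ⊄ G`: the strict ancestors are
nested and finitely many; a rational disc inside the smallest of them, about a point it surrounds
outside `G`, is surrounded by all of them. -/
theorem ncard_loops_ssurrounding_eq_sSup {c : LoopConfig ℂ} (hc : Regular c) {G : Set ℂ}
    {z₀ : ℂ} {r₀ : ℝ} (hr₀ : 0 < r₀) (hD : closedBall z₀ r₀ ⊆ G) (R : ℝ) :
    {u ∈ c.loops | u.range ⊆ ball (0 : ℂ) R ∧ G ⊂ {w | u.wind w ≠ 0}}.ncard =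
      sSup {m | ∃ (q : ℚ × ℚ) (s : ℚ), 0 < s ∧ ¬ ball (⟨q.1, q.2⟩ : ℂ) s ⊆ G ∧
        m = {u ∈ c.loops | u.range ⊆ ball (0 : ℂ) R ∧
          G ∪ ball (⟨q.1, q.2⟩ : ℂ) s ⊆ {w | u.wind w ≠ 0}}.ncard} := by
  classical
  set St : Set (UnbasedLoop ℂ) :=
    {u ∈ c.loops | u.range ⊆ ball (0 : ℂ) R ∧ G ⊂ {w | u.wind w ≠ 0}} with hSt
  have hStfin : St.Finite :=
    (finite_loops_surrounding_closedBall hc.locallyFinite z₀ hr₀ R).subset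
      fun u hu ↦ ⟨hu.1, hu.2.1, hD.trans hu.2.2.subset⟩
  -- every enlarged ancestor count is at most the strict-ancestor count
  have hupper : ∀ (q : ℚ × ℚ) (s : ℚ), ¬ ball (⟨q.1, q.2⟩ : ℂ) s ⊆ G →
      {u ∈ c.loops | u.range ⊆ ball (0 : ℂ) R ∧
        G ∪ ball (⟨q.1, q.2⟩ : ℂ) s ⊆ {w | u.wind w ≠ 0}} ⊆ St := by
    intro q s hB u hu
    refine ⟨hu.1, hu.2.1, (Set.union_subset_iff.1 hu.2.2).1.ssubset_of_ne ?_⟩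
    intro hGe
    exact hB (hGe ▸ (Set.union_subset_iff.1 hu.2.2).2)
  have hub : St.ncard ∈ upperBounds {m | ∃ (q : ℚ × ℚ) (s : ℚ), 0 < s ∧
      ¬ ball (⟨q.1, q.2⟩ : ℂ) s ⊆ G ∧ m = {u ∈ c.loops | u.range ⊆ ball (0 : ℂ) R ∧
        G ∪ ball (⟨q.1, q.2⟩ : ℂ) s ⊆ {w | u.wind w ≠ 0}}.ncard} := by
    rintro m ⟨q, s, -, hB, rfl⟩
    exact Set.ncard_le_ncard (hupper q s hB) hStfin
  by_cases hne : St.Nonempty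
  · -- attained: a rational disc inside the smallest strict ancestor, about a point outside `G`
    obtain ⟨u₁, hu₁, hmin⟩ :=
      hStfin.exists_minimalFor (fun u : UnbasedLoop ℂ ↦ {w | u.wind w ≠ 0}) _ hne
    have hz₀ : z₀ ∈ closedBall z₀ r₀ := mem_closedBall_self hr₀.le
    have habove : ∀ u ∈ St, {w | u₁.wind w ≠ 0} ⊆ {w | u.wind w ≠ 0} := by
      intro u hu
      rcases interiors_nested_of_wind_ne_zero hc hu₁.1 hu.1 (hu₁.2.2.subset (hD hz₀))
        (hu.2.2.subset (hD hz₀)) with h | h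
      · exact h
      · exact hmin hu h
    obtain ⟨z, hz, hzG⟩ := Set.exists_of_ssubset hu₁.2.2
    obtain ⟨ε, hε, hball⟩ := Metric.isOpen_iff.1 u₁.isOpen_setOf_wind_ne_zero z hz
    obtain ⟨q, s, hs, hdist, hsum⟩ := exists_rat_closedBall_near z hε
    have hBsub : ball (⟨q.1, q.2⟩ : ℂ) s ⊆ {w | u₁.wind w ≠ 0} :=
      ball_subset_closedBall.trans ((closedBall_subset_ball_of_add_dist_lt hsum).trans hball)
    have hBG : ¬ ball (⟨q.1, q.2⟩ : ℂ) s ⊆ G := fun h ↦ hzG (h (mem_ball.2 hdist))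
    have heq : {u ∈ c.loops | u.range ⊆ ball (0 : ℂ) R ∧
        G ∪ ball (⟨q.1, q.2⟩ : ℂ) s ⊆ {w | u.wind w ≠ 0}} = St := by
      refine (hupper q s hBG).antisymm fun u hu ↦ ⟨hu.1, hu.2.1, ?_⟩
      exact Set.union_subset hu.2.2.subset (hBsub.trans (habove u hu))
    have hmem : St.ncard ∈ {m | ∃ (q : ℚ × ℚ) (s : ℚ), 0 < s ∧ ¬ ball (⟨q.1, q.2⟩ : ℂ) s ⊆ G ∧
        m = {u ∈ c.loops | u.range ⊆ ball (0 : ℂ) R ∧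
          G ∪ ball (⟨q.1, q.2⟩ : ℂ) s ⊆ {w | u.wind w ≠ 0}}.ncard} :=
      ⟨q, s, hs, hBG, by rw [heq]⟩
    exact (IsGreatest.csSup_eq ⟨hmem, hub⟩).symm
  · -- not attained: there are no strict ancestors and every enlarged count vanishes
    have h0 : St.ncard = 0 := by
      rw [Set.not_nonempty_iff_eq_empty.1 hne, Set.ncard_empty]
    refine le_antisymm (h0 ▸ Nat.zero_le _) (csSup_le' hub)

/-- **Ancestors = the set itself + strict ancestors**: for a set `G` containing a closed disc of
positive radius (so that everything is finite in a regular configuration), the loops of the window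
whose interior contains `G` are those whose interior IS `G` together with the strict ancestors. -/
theorem ncard_loops_surrounding_eq_add {c : LoopConfig ℂ} (hc : Regular c) (G : Set ℂ) {z₀ : ℂ}
    {r₀ : ℝ} (hr₀ : 0 < r₀) (hD : closedBall z₀ r₀ ⊆ G) (R : ℝ) :
    {u ∈ c.loops | u.range ⊆ ball (0 : ℂ) R ∧ G ⊆ {w | u.wind w ≠ 0}}.ncard =
      {u ∈ c.loops | u.range ⊆ ball (0 : ℂ) R ∧ {w | u.wind w ≠ 0} = G}.ncard +
        {u ∈ c.loops | u.range ⊆ ball (0 : ℂ) R ∧ G ⊂ {w | u.wind w ≠ 0}}.ncard := by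
  have hfin := finite_loops_surrounding_closedBall hc.locallyFinite z₀ hr₀ R
  rw [← Set.ncard_union_eq ?_ (hfin.subset ?_) (hfin.subset ?_)]
  · congr 1
    ext u
    simp only [mem_sep_iff, mem_union]
    constructor
    · rintro ⟨hul, hur, hG⟩
      rcases hG.eq_or_ssubset with h | h
      · exact Or.inl ⟨hul, hur, h.symm⟩
      · exact Or.inr ⟨hul, hur, h⟩
    · rintro (⟨hul, hur, h⟩ | ⟨hul, hur, h⟩)
      · exact ⟨hul, hur, h.symm.subset⟩
      · exact ⟨hul, hur, h.subset⟩
  · exact Set.disjoint_left.2 fun u hu hu' ↦ hu'.2.2.ne hu.2.2.symm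
  · exact fun u hu ↦ ⟨hu.1, hu.2.1, hu.2.2 ▸ hD⟩
  · exact fun u hu ↦ ⟨hu.1, hu.2.1, hD.trans hu.2.2.subset⟩

end Summit.CriticalPhenomena.CardyFormulaZ2.Cruxes.NestingRigidity.RingCloudTomography

end
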